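import Mathlib

/-!
# A non-zero functional on a union of subspaces is non-zero on one of them — the level / K-type
reduction of Lemma N5.L1 (kernel witness for the [A]-step behind [G-N5.2])

Blind cell `pub-hodge-repro2`, seat p4, Tier-5 support. README §8(d): this file uses an
L-value-free non-vanishing device: NO (a kernel check of an elementary step already on the cell's
record).

`route/T5-route-2.md` §N5.11.7 records Lemma N5.L1 [A] (the residual [G-N5.2], «minor»): «P ≢ 0
on π₀ ⇒ P ≢ 0 on π₀^{K₀,τ′} for an explicit open compact K₀» — the reduction of the non-vanishing
of the toric period functional from the whole representation to the vectors of a fixed level `K₀`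
and a fixed `K_∞`-type `τ′`. Its algebraic content is: a non-zero linear functional on a vector
space that is the sum (here: the union) of a family of subspaces is non-zero on at least one of
them — applied twice, to the levels `V^K` (`π₀ = ⋃_K π₀^K`, smoothness) and to the `K_∞`-types
inside `V^K` (`V^K = ⨁_τ V^K[τ]`, the finite decomposition of `T5CharacterProjectors`).

* `exists_mem_ne_zero_of_iSup_eq_top` — `⨆ i, W i = ⊤`, `P ≠ 0` ⇒ `∃ i, ∃ v ∈ W i, P v ≠ 0`;
* `exists_restrict_ne_zero_of_iSup_eq_top` — the same with `P.domRestrict (W i) ≠ 0`;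
* `exists_mem_ne_zero_of_iSup_iSup_eq_top` — two-level version: `⨆ K, ⨆ τ, W K τ = ⊤` ⇒ some
  `W K τ` carries a vector with `P v ≠ 0`;
* `exists_mem_ne_zero_of_directed` — the union form: if every vector lies in some `W i`
  (`∀ v, ∃ i, v ∈ W i`, the smoothness hypothesis as stated), then `P ≠ 0` is witnessed inside some
  `W i`.

Nothing automorphic is modelled (no group, no level structure, no `K_∞`-type): the statement is
about an arbitrary complex vector space `V` and an arbitrary family of subspaces.

Mathlib only; no sorry; axioms ⊆ {propext, Classical.choice, Quot.sound}.
-/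

namespace Summit.Ventures.HodgeRepro2.T5LevelReduction

variable {V : Type*} [AddCommGroup V] [Module ℂ V]

/-- If `P` vanishes on every member of a family of subspaces, it vanishes on their supremum. -/
theorem apply_eq_zero_of_mem_iSup {ι : Type*} (W : ι → Submodule ℂ V) (P : V →ₗ[ℂ] ℂ)
    (hP : ∀ i, ∀ v ∈ W i, P v = 0) {x : V} (hx : x ∈ ⨆ i, W i) : P x = 0 := by
  refine Submodule.iSup_induction (motive := fun y => P y = 0) W hx hP (map_zero P) ?_
  intro y z hy hz
  rw [map_add, hy, hz, add_zero]

/-- A non-zero functional on `V = ⨆ W i` is non-zero on some `W i`. -/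
theorem exists_mem_ne_zero_of_iSup_eq_top {ι : Type*} (W : ι → Submodule ℂ V)
    (hW : ⨆ i, W i = ⊤) (P : V →ₗ[ℂ] ℂ) (hP : P ≠ 0) : ∃ i, ∃ v ∈ W i, P v ≠ 0 := by
  by_contra h
  push Not at h
  apply hP
  ext x
  rw [LinearMap.zero_apply]
  exact apply_eq_zero_of_mem_iSup W P h (hW ▸ Submodule.mem_top)

/-- The same, as the non-vanishing of the restriction of `P` to some `W i`. -/
theorem exists_restrict_ne_zero_of_iSup_eq_top {ι : Type*} (W : ι → Submodule ℂ V)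
    (hW : ⨆ i, W i = ⊤) (P : V →ₗ[ℂ] ℂ) (hP : P ≠ 0) : ∃ i, P.domRestrict (W i) ≠ 0 := by
  obtain ⟨i, v, hv, hPv⟩ := exists_mem_ne_zero_of_iSup_eq_top W hW P hP
  refine ⟨i, fun h => hPv ?_⟩
  have := DFunLike.congr_fun h ⟨v, hv⟩
  simpa using this

/-- The union form (smoothness as stated: every vector has a level): if every `v` lies in some
`W i`, a non-zero `P` is non-zero on some `W i`. -/
theorem exists_mem_ne_zero_of_directed {ι : Type*} (W : ι → Submodule ℂ V)
    (hW : ∀ v : V, ∃ i, v ∈ W i) (P : V →ₗ[ℂ] ℂ) (hP : P ≠ 0) : ∃ i, ∃ v ∈ W i, P v ≠ 0 := by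
  refine exists_mem_ne_zero_of_iSup_eq_top W ?_ P hP
  rw [eq_top_iff]
  intro v _
  obtain ⟨i, hi⟩ := hW v
  exact Submodule.mem_iSup_of_mem i hi

/-- The two-level version used in N5.L1: levels `K` and `K_∞`-types `τ` — if `V = ⨆_K ⨆_τ W K τ`,
a non-zero `P` is non-zero on some `W K τ` («P ≢ 0 on π₀^{K₀,τ′}»). -/
theorem exists_mem_ne_zero_of_iSup_iSup_eq_top {κ σ : Type*} (W : κ → σ → Submodule ℂ V)
    (hW : ⨆ K, ⨆ τ, W K τ = ⊤) (P : V →ₗ[ℂ] ℂ) (hP : P ≠ 0) :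
    ∃ K τ, ∃ v ∈ W K τ, P v ≠ 0 := by
  obtain ⟨K, v, hv, hPv⟩ := exists_mem_ne_zero_of_iSup_eq_top (fun K => ⨆ τ, W K τ) hW P hP
  by_contra h
  push Not at h
  exact hPv (apply_eq_zero_of_mem_iSup (W K) P (h K) hv)

/-- The same, from the union forms of both hypotheses: every vector has a level `K`, and every
vector of level `K` is a finite sum of `K_∞`-type vectors of level `K`
(`⨆ τ, W K τ = V^K`). -/
theorem exists_mem_ne_zero_of_level_and_type {κ σ : Type*} (level : κ → Submodule ℂ V)
    (hlevel : ∀ v : V, ∃ K, v ∈ level K) (W : κ → σ → Submodule ℂ V)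
    (htype : ∀ K, ⨆ τ, W K τ = level K) (P : V →ₗ[ℂ] ℂ) (hP : P ≠ 0) :
    ∃ K τ, ∃ v ∈ W K τ, P v ≠ 0 := by
  refine exists_mem_ne_zero_of_iSup_iSup_eq_top W ?_ P hP
  simp_rw [htype]
  rw [eq_top_iff]
  intro v _
  obtain ⟨K, hK⟩ := hlevel v
  exact Submodule.mem_iSup_of_mem K hK

end Summit.Ventures.HodgeRepro2.T5LevelReduction
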